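import Summits.PneNP.GCT.Max.KYPaddingTransport
import Literature.Computability.AlgebraicComplexity.OrbitClosureProofs
import Literature.Computability.AlgebraicComplexity.DeterminantBorderWaringRank
import HarnessLib
import HarnessLib.Audit

/-!
# `GCT/Max`: the cone step of theory-2's transport identity — dominance of Koszul–Young tables survives adding free
# letters (R-F-T2-25 at `s = 0` = law L1), hence "R-F-T2-25 + the 9-letter tables ⇒ S (`KYBlindPaddedPerThree`)"

Cell `pub-gct-max` (HOME `run/shared/lean/pub/pub-gct-max/`), track F; lead D110 (a) / D153 ("the n²-letter edges to S / L6
(iterate s = 0) only if they fit the same session"): companion of `Max/KYPaddingTransport.lean` (the typed node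
`KYPaddingTransportLaw` = R-F-T2-25, the 9-letter node `KYCubicsDominance`, and the proved edge to C-F-1
`KYBlindPaddedPerThreeOwn`). HERE the second edge, to the law-level statement **S** of
`Conjectures/KYFlatteningBlindPaddedPerThree.lean` (the `n²`-letter comparison `rank KY_{p,k}(X₀₀^{n-3}·per₃) ≤
rank KY_{p,k}(X₀₀^{n-3}·det₃(block))`): `TransportImpliesBlind : KYPaddingTransportLaw → KYCubicsDominance → KYBlindPaddedPerThree`,
PROVED. Mechanism (lit-2's D110 (a) answer, HOME INBOX l.437; lead D153 "derivation read and found consistent"): the `s = 0`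
instance of the identity reads `KY_{p,k}(f ⊕ one free letter) = KY_{p-1,k}(f) + KY_{p,k}(f)`, which is MONOTONE in the table of
`f`; iterating it along the `n² - 10` letters outside the padded block transports the 10-letter dominance (C-F-1) to `n²` letters
(`KYCone.dominance_rename`: cellwise dominance of two forms of the same degree is preserved under renaming along ANY injection of
letters — induction on the number of new letters, peeling one letter with `Equiv.optionSubtypeNe`). No Vandermonde closed form is
needed for S (it would be for the equality L6, not typed here). Everything in this file is PROVED; the two hypotheses are the
obligation nodes of `KYPaddingTransport.lean`; nothing of the accepted Conjectures file is edited. HONEST FRAMING: multiplicity data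
and certified rank bounds at small parameters; occurrence obstructions are ruled out in print (BIP'16) — multiplicity obstructions
are the open door; nothing here is a claim on VP vs VNP or P vs NP.

## References
* theory-2, FLAT-PLAN v3.3 §L.7 (R-F-T2-25; "s = 0 is engine-3's cone law L1"); engine-3 law L1 (cone decomposition, 100/100 cells).
* [LandsbergGCT2017] §8.2.1 eq. (8.2.1) (the flattening is a `GL(V)`-module map — renaming invariance, tree `kyRank_eq_kyRankFin_rename_equiv`).
-/

noncomputable section

open MvPolynomial

namespace Summit.PneNP.GCT

open Literature.Computability.AlgebraicComplexity Literature.Barriers.ValiantsHypothesis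

namespace KYCone

/-! ## Renaming invariance and vanishing, numbering-free -/

/-- `kyRank` is invariant under renaming the letters along a bijection. [folklore] -/
theorem kyRank_rename_equiv {σ τ : Type*} [Fintype σ] [DecidableEq σ] [Fintype τ] [DecidableEq τ]
    (e : σ ≃ τ) (p k : ℕ) (F : MvPolynomial σ ℂ) :
    kyRank ℂ p k (rename e F) = kyRank ℂ p k F := by
  rw [kyRank_def, rename_rename, kyRank_eq_kyRankFin_rename_equiv (e.trans (Fintype.equivFin τ)) p k F]
  rfl

/-- `KY_{p,k}(F) = 0` for a form of degree `d ≤ k`. [folklore] -/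
theorem kyRank_eq_zero_of_deg_le {σ : Type*} [Fintype σ] [DecidableEq σ] {F : MvPolynomial σ ℂ} {d : ℕ}
    (hF : F.IsHomogeneous d) (p k : ℕ) (hk : d ≤ k) : kyRank ℂ p k F = 0 := by
  rw [kyRank_def]
  exact SF6PerSide.kyRankFin_eq_zero_of_isHomogeneous p k _ hF.rename_isHomogeneous hk

/-- `KY_{p,k}(F) = 0` for `p ≥` the number of letters. [folklore] -/
theorem kyRank_eq_zero_of_card_le {σ : Type*} [Fintype σ] [DecidableEq σ] (F : MvPolynomial σ ℂ) (p k : ℕ)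
    (hp : Fintype.card σ ≤ p) : kyRank ℂ p k F = 0 := by
  rw [kyRank_def]
  exact kyRankFin_eq_zero_of_card_le p k _ hp

/-! ## One free letter: the `s = 0` instance of the transport law -/

/-- Under `KYPaddingTransportLaw`: `KY_{p,k}(f ⊕ one free letter) = KY_{p-1,k}(f) + KY_{p,k}(f)` (`p ≤ N`, `k + 1 ≤ d`;
the law at `s = 0`, i.e. engine-3's cone law L1 for one letter). [folklore] -/
theorem kyRank_rename_some_of_law (hlaw : KYPaddingTransportLaw) {σ : Type} [Fintype σ] [DecidableEq σ]
    (F : MvPolynomial σ ℂ) {d : ℕ} (hF : F.IsHomogeneous d) (p k : ℕ) (hp : p ≤ Fintype.card σ)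
    (hk : k + 1 ≤ d) :
    kyRank ℂ p k (rename some F) = (if 1 ≤ p then kyRank ℂ (p - 1) k F else 0) + kyRank ℂ p k F := by
  have h := hlaw σ F d hF 0 p k hp (by omega)
  simpa using h

/-! ## Dominance of tables survives adding free letters -/

/-- **Cone monotonicity (under the transport law).** If two forms `F, G` of the same degree in the letters `σ` satisfy
`KY_{p,k}(F) ≤ KY_{p,k}(G)` for all `(p,k)`, then so do `F, G` renamed along any INJECTION `ι : σ → τ` of letters
(induction on `#τ - #σ`, one free letter at a time). [folklore] -/
theorem dominance_rename (hlaw : KYPaddingTransportLaw) (m : ℕ) :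
    ∀ (σ τ : Type) [Fintype σ] [DecidableEq σ] [Fintype τ] [DecidableEq τ]
      (F G : MvPolynomial σ ℂ) (d : ℕ), F.IsHomogeneous d → G.IsHomogeneous d →
      (∀ p k : ℕ, kyRank ℂ p k F ≤ kyRank ℂ p k G) →
      ∀ ι : σ → τ, Function.Injective ι → Fintype.card τ = Fintype.card σ + m →
      ∀ p k : ℕ, kyRank ℂ p k (rename ι F) ≤ kyRank ℂ p k (rename ι G) := by
  induction m with
  | zero =>
    intro σ τ _ _ _ _ F G d _ _ hdom ι hι hcard p k
    have hbij : Function.Bijective ι :=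
      (Fintype.bijective_iff_injective_and_card ι).2 ⟨hι, by omega⟩
    change kyRank ℂ p k (rename (Equiv.ofBijective ι hbij) F) ≤ kyRank ℂ p k (rename (Equiv.ofBijective ι hbij) G)
    rw [kyRank_rename_equiv, kyRank_rename_equiv]
    exact hdom p k
  | succ m ih =>
    intro σ τ _ _ _ _ F G d hF hG hdom ι hι hcard p k
    classical
    -- a letter outside the image
    have hns : ¬ Function.Surjective ι := fun hs => by
      have := Fintype.card_le_of_surjective ι hs
      omega
    obtain ⟨t₀, ht₀⟩ : ∃ t₀ : τ, ∀ x, ι x ≠ t₀ := by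
      simpa [Function.Surjective] using hns
    let ι' : σ → {t : τ // t ≠ t₀} := fun x => ⟨ι x, ht₀ x⟩
    have hι' : Function.Injective ι' := fun a b hab => hι (by simpa [ι'] using congrArg Subtype.val hab)
    have hcard' : Fintype.card {t : τ // t ≠ t₀} = Fintype.card σ + m := by
      have h1 := Fintype.card_congr (Equiv.optionSubtypeNe t₀)
      rw [Fintype.card_option] at h1
      omega
    have hfun : (⇑(Equiv.optionSubtypeNe t₀) ∘ some) ∘ ι' = ι := funext fun _ => rfl
    have hkeyF : rename ι F = rename (Equiv.optionSubtypeNe t₀) (rename some (rename ι' F)) := by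
      rw [rename_rename, rename_rename, hfun]
    have hkeyG : rename ι G = rename (Equiv.optionSubtypeNe t₀) (rename some (rename ι' G)) := by
      rw [rename_rename, rename_rename, hfun]
    rw [hkeyF, hkeyG, kyRank_rename_equiv, kyRank_rename_equiv]
    have hF' : (rename ι' F).IsHomogeneous d := hF.rename_isHomogeneous
    have hG' : (rename ι' G).IsHomogeneous d := hG.rename_isHomogeneous
    have ih' := ih σ {t : τ // t ≠ t₀} F G d hF hG hdom ι' hι' hcard'
    by_cases hk : d ≤ k
    · rw [kyRank_eq_zero_of_deg_le hF'.rename_isHomogeneous p k hk]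
      exact Nat.zero_le _
    by_cases hp : Fintype.card {t : τ // t ≠ t₀} + 1 ≤ p
    · rw [kyRank_eq_zero_of_card_le _ p k (by rw [Fintype.card_option]; exact hp)]
      exact Nat.zero_le _
    rw [kyRank_rename_some_of_law hlaw _ hF' p k (by omega) (by omega),
      kyRank_rename_some_of_law hlaw _ hG' p k (by omega) (by omega)]
    refine add_le_add ?_ (ih' p k)
    split_ifs
    · exact ih' _ _
    · exact le_rfl

/-! ## The padded cubics in `n²` letters as renamings of the 10-letter objects -/

/-- The letters of the padded block: the corner `(0,0)` (`none`) and the bottom-right `3 × 3` block. [folklore] -/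
def coneEmb (n : ℕ) [NeZero n] : Option (BlockIdx 3 n × BlockIdx 3 n) → Fin n × Fin n
  | none => (0, 0)
  | some ij => ((ij.1 : Fin n), (ij.2 : Fin n))

/-- For `n ≥ 4` the corner is not in the block, so `coneEmb` is injective. [folklore] -/
theorem coneEmb_injective (n : ℕ) [NeZero n] (hn : 4 ≤ n) : Function.Injective (coneEmb n) := by
  rintro (_ | ⟨a, b⟩) (_ | ⟨a', b'⟩) h
  · rfl
  · simp only [coneEmb, Prod.mk.injEq] at h
    have h2 := a'.2
    have h1 : ((0 : Fin n) : ℕ) = ((a' : Fin n) : ℕ) := congrArg Fin.val h.1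
    rw [Fin.val_zero] at h1
    omega
  · simp only [coneEmb, Prod.mk.injEq] at h
    have h2 := a.2
    have h1 : ((a : Fin n) : ℕ) = ((0 : Fin n) : ℕ) := congrArg Fin.val h.1
    rw [Fin.val_zero] at h1
    omega
  · simp only [coneEmb, Prod.mk.injEq] at h
    rw [Subtype.ext h.1, Subtype.ext h.2]

/-- The block permanent padded on its own 10 letters (block-indexed version of `ownPaddedPerPoly 3 n`). [folklore] -/
def blockOwnPer (n : ℕ) : MvPolynomial (Option (BlockIdx 3 n × BlockIdx 3 n)) ℂ :=
  X none ^ (n - 3) * rename some (perPoly (BlockIdx 3 n) ℂ)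

/-- The block determinant padded on its own 10 letters (block-indexed version of `ownPaddedDetPoly 3 n`). [folklore] -/
def blockOwnDet (n : ℕ) : MvPolynomial (Option (BlockIdx 3 n × BlockIdx 3 n)) ℂ :=
  X none ^ (n - 3) * rename some (detPoly (BlockIdx 3 n) ℂ)

/-- `paddedPerPoly ℂ 3 n` is `blockOwnPer n` renamed along `coneEmb`. [folklore] -/
theorem paddedPerPoly_eq_rename (n : ℕ) [NeZero n] : paddedPerPoly ℂ 3 n = rename (coneEmb n) (blockOwnPer n) := by
  rw [paddedPerPoly, blockOwnPer, map_mul, map_pow, rename_X, rename_rename]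
  rfl

/-- `paddedDetPoly ℂ 3 n` is `blockOwnDet n` renamed along `coneEmb`. [folklore] -/
theorem paddedDetPoly_eq_rename (n : ℕ) [NeZero n] : paddedDetPoly ℂ 3 n = rename (coneEmb n) (blockOwnDet n) := by
  rw [paddedDetPoly, blockOwnDet, map_mul, map_pow, rename_X, rename_rename]
  rfl

/-- The generic determinant is natural under bijections of the index type. [folklore] -/
private theorem rename_detPoly_equiv' {m m' : Type*} [Fintype m] [DecidableEq m] [Fintype m'] [DecidableEq m']
    (e : m' ≃ m) : rename (Prod.map e e) (detPoly m' ℂ) = detPoly m ℂ := by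
  unfold detPoly
  rw [AlgHom.map_det]
  have h : (rename (Prod.map (⇑e) (⇑e)) : MvPolynomial (m' × m') ℂ →ₐ[ℂ] MvPolynomial (m × m) ℂ).mapMatrix
      (Matrix.mvPolynomialX m' m' ℂ) = (Matrix.mvPolynomialX m m ℂ).submatrix e e := by
    ext i j
    simp [Matrix.mvPolynomialX_apply, rename_X]
  rw [h, Matrix.det_submatrix_equiv_self]

/-- `blockOwnPer n` is `ownPaddedPerPoly 3 n` with the block letters renumbered. [folklore] -/
theorem blockOwnPer_eq_rename (n : ℕ) (e : Fin 3 ≃ BlockIdx 3 n) :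
    blockOwnPer n = rename (Option.map (Prod.map e e)) (ownPaddedPerPoly 3 n) := by
  rw [ownPaddedPerPoly, blockOwnPer, map_mul, map_pow, rename_X, rename_rename, ← rename_perPoly_equiv (k := ℂ) e,
    rename_rename]
  rfl

/-- `blockOwnDet n` is `ownPaddedDetPoly 3 n` with the block letters renumbered. [folklore] -/
theorem blockOwnDet_eq_rename (n : ℕ) (e : Fin 3 ≃ BlockIdx 3 n) :
    blockOwnDet n = rename (Option.map (Prod.map e e)) (ownPaddedDetPoly 3 n) := by
  rw [ownPaddedDetPoly, blockOwnDet, map_mul, map_pow, rename_X, rename_rename, ← rename_detPoly_equiv' e,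
    rename_rename]
  rfl

/-- `blockOwnPer n` is a form of degree `n` (`n ≥ 3`). [folklore] -/
theorem blockOwnPer_isHomogeneous (n : ℕ) (hn : 3 ≤ n) (e : Fin 3 ≃ BlockIdx 3 n) :
    (blockOwnPer n).IsHomogeneous n := by
  rw [blockOwnPer_eq_rename n e]
  exact (ownPaddedPerPoly_isHomogeneous hn).rename_isHomogeneous

/-- `blockOwnDet n` is a form of degree `n` (`n ≥ 3`). [folklore] -/
theorem blockOwnDet_isHomogeneous (n : ℕ) (hn : 3 ≤ n) (e : Fin 3 ≃ BlockIdx 3 n) :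
    (blockOwnDet n).IsHomogeneous n := by
  rw [blockOwnDet_eq_rename n e, ownPaddedDetPoly]
  have h1 := isHomogeneous_X_pow (R := ℂ) (none : Option (Fin 3 × Fin 3)) (n - 3)
  have h2 := (detPoly_isHomogeneous (n := Fin 3) (k := ℂ)).rename_isHomogeneous
    (f := (some : Fin 3 × Fin 3 → Option (Fin 3 × Fin 3)))
  have := h1.mul h2
  simp only [Fintype.card_fin] at this
  rw [Nat.sub_add_cancel hn] at this
  exact this.rename_isHomogeneous

end KYCone

/-! ## The edge to S -/

/-- The implication **R-F-T2-25 ⇒ (9-letter dominance ⇒ S)** as a named statement (shape α). [folklore] -/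
def TransportImpliesBlind : Prop :=
  KYPaddingTransportLaw → KYCubicsDominance → KYBlindPaddedPerThree

/-- **R-F-T2-25 ⇒ (9-letter dominance ⇒ S) holds**: C-F-1 (`transportImpliesBlindOwn_holds`) gives the 10-letter
dominance; renumber the block letters (`BlockIdx 3 n ≃ Fin 3`), then transport along the injection `coneEmb n` into the
`n²` letters by cone monotonicity (`KYCone.dominance_rename`, the `s = 0` law iterated `n² - 10` times). [folklore] -/
theorem transportImpliesBlind_holds : TransportImpliesBlind := by
  intro hlaw hdom n _ hn p k
  classical
  have hown := transportImpliesBlindOwn_holds hlaw hdom n hn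
  have e : Fin 3 ≃ BlockIdx 3 n := (Fintype.equivFinOfCardEq (card_blockIdx (show 3 ≤ n by omega))).symm
  have hdom10 : ∀ p k : ℕ, kyRank ℂ p k (KYCone.blockOwnPer n) ≤ kyRank ℂ p k (KYCone.blockOwnDet n) := by
    intro p k
    rw [KYCone.blockOwnPer_eq_rename n e, KYCone.blockOwnDet_eq_rename n e]
    change kyRank ℂ p k (rename (Equiv.optionCongr (Equiv.prodCongr e e)) (ownPaddedPerPoly 3 n)) ≤
      kyRank ℂ p k (rename (Equiv.optionCongr (Equiv.prodCongr e e)) (ownPaddedDetPoly 3 n))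
    rw [KYCone.kyRank_rename_equiv, KYCone.kyRank_rename_equiv]
    exact hown p k
  rw [KYCone.paddedPerPoly_eq_rename, KYCone.paddedDetPoly_eq_rename]
  exact KYCone.dominance_rename hlaw (Fintype.card (Fin n × Fin n) - Fintype.card (Option (BlockIdx 3 n × BlockIdx 3 n)))
    _ _ (KYCone.blockOwnPer n) (KYCone.blockOwnDet n) n (KYCone.blockOwnPer_isHomogeneous n (by omega) e)
    (KYCone.blockOwnDet_isHomogeneous n (by omega) e) hdom10 (KYCone.coneEmb n) (KYCone.coneEmb_injective n hn)
    (by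
      have hle := Fintype.card_le_of_injective _ (KYCone.coneEmb_injective n hn)
      omega) p k

end Summit.PneNP.GCT
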